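import Mathlib
import HarnessLib
import Summits.HubbardSuperconductivity.HubbardSuperconductivity.Theorems.KLProgrammeKLRegimeEngineTowerDoorToKitGraded
import Literature.MathematicalPhysics.QuantumLattice.FermiRG.BGM2006LevelRouting

/-!
# Route `KLProgramme` — crux K3 ENGINE (stmt-HubbardSuperconductivity-20437 `KLRegimeEngineV17F2`), stub (b) v2, THE LEVELS PACKAGE (ℓ), located-risk #10
# residual, LINK-F kit side: RE-TRUNCATION OF THE ORIENTED BRACKET — the tail earns the floor weight by truncation depth
# (cell gate-hubbard-kl, seat hubbard-kl-k3c2-p3 g14; the oriented twin of …TowerDoorToKitGraded §3 (g12); E1 / the LINK-F lane may rename or supersede)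

k3c3-p2's oriented kit form (`…TowerBlockIncrLevOrientedKitGeneric.klLevNormOf_le_kit_oriented_of_doorForm`, p680457) returns, per prescription of level `F`,
the bracket `θ^{lumps F}·Σ_{n ∈ [2, N₀−1]} e·Φ^{n−1}·ψ^p·towerS D τ Bm n p + ψ^p·(e·V·(ΦV)^{N₀−1}/(1 − ΦV))` at the door's truncation `N₀`: the graded orders carry
the floor weight `θ^{lumps F}`, the TAIL does not.  Dividing by the output unit `klLevUnitF … t p (dk) ∝ (2^{−dk})^{lumps F}` (p4's law rethread) would charge the
tail `2^{lumps F·dk}`.  The cure is g12's re-truncation device («(I1)-LEV-GRADED-UNITS», `doorGradedPrescribed_le_kitStep_graded`): call the door at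
`N₀ := N + K + 1` with `(1/2)^K ≤ θ^{lumps F}` and run the guard at `2Φ`; the extra graded orders `(N, N+K]` sit under the kit tail (`sum_extraOrders_le_kitTail`),
the door's tail pays `(ΦV)^K ≤ (1/2)^K ≤ θ^{lumps F}`, and `2·tail(Φ, N) ≤ tail(2Φ, N)` (`two_mul_kitTail_le`).  Pure real algebra, ONE array `μ` for both parts
(in the tower: `Nt := Bm`, admissible since `ε·klTowerMeasLev … (2m) 0 = ε·klTowerMeasLev … (2m) 1 ≤ Bm m`, …TowerLevOrientedDictF):

* **`orientedBracket_retruncate_le_kitStep`** — `w·Σ_{n∈[2,N+K]} e·Φ^{n−1}·ψ^p·S_n + ψ^p·e·V·(ΦV)^{N+K}/(1−ΦV) ≤ w·(Σ_{n∈[2,N]} e·(2Φ)^{n−1}·ψ^p·S_n + ψ^p·e·V·(2ΦV)^N/(1−2ΦV))`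
  for `0 ≤ w`, `(1/2)^K ≤ w`, `N ≥ 1`, `2ΦV < 1` — the literal `hstep` bracket with `Φ ↦ 2Φ`, ALL of it weighted;
* `half_pow_two_mul_le_pow_lumps` — the depth row for the floor weight: `(1/2)^{2J} ≤ ((1/2)^J)^{lumps F}` (`lumps ≤ 2`), i.e. `K := 2(dk−1)` serves every level.
Nothing about the model; nothing asserts (ℓ), any stub, K3 or superconductivity.
References: BGM 2006 §3 (3.2)–(3.8) [cite: BenfattoGiulianiMastropietro2006].
-/

noncomputable section

namespace Summit.HubbardSuperconductivity.HubbardSuperconductivity.Theorems.EngineV8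

set_option linter.dupNamespace false -- summit = problem name (single-conjunct summit), D-0017

open Real Finset
open Literature.MathematicalPhysics.QuantumLattice.FermiRG.BGM2006Routing

/-- **RE-TRUNCATION OF THE ORIENTED BRACKET: the tail earns the weight.**  For `0 ≤ τ, ψ, Φ`, sizes `μ ≥ 0`, a weight `w ≥ 0` with `(1/2)^K ≤ w`, the kit's
truncation `N ≥ 1` and the quantitative guard `2Φ·V < 1` (`V = towerV D τ μ`): the oriented bracket at the door's truncation `N + K + 1` — graded orders
`[2, N+K]` weighted by `w`, tail unweighted — is at most `w` times the literal kit bracket at truncation `N` with `Φ ↦ 2Φ`. -/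
theorem orientedBracket_retruncate_le_kitStep {D p N K : ℕ} {τ ψ Φ w : ℝ} {μ : ℕ → ℝ} (hτ : 0 ≤ τ) (hψ : 0 ≤ ψ) (hΦ : 0 ≤ Φ) (hμ : ∀ m, 0 ≤ μ m)
    (hw0 : 0 ≤ w) (hK : (1 / 2 : ℝ) ^ K ≤ w) (hN : 1 ≤ N) (hguard2 : 2 * Φ * towerV D τ μ < 1) :
    w * ∑ n ∈ Icc 2 (N + K + 1 - 1), exp 1 * Φ ^ (n - 1) * ψ ^ p * towerS D τ μ n p +
        ψ ^ p * (exp 1 * towerV D τ μ * (Φ * towerV D τ μ) ^ (N + K + 1 - 1) / (1 - Φ * towerV D τ μ)) ≤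
      w * (∑ n ∈ Icc 2 N, exp 1 * (2 * Φ) ^ (n - 1) * ψ ^ p * towerS D τ μ n p +
        ψ ^ p * (exp 1 * towerV D τ μ * (2 * Φ * towerV D τ μ) ^ N / (1 - 2 * Φ * towerV D τ μ))) := by
  set V := towerV D τ μ with hVdef
  have hV0 : 0 ≤ V := towerV_nonneg hτ hμ
  have hΦV0 : 0 ≤ Φ * V := mul_nonneg hΦ hV0
  have hΦVhalf : Φ * V ≤ 1 / 2 := by nlinarith
  have hguard : Φ * V < 1 := by linarith
  set S : ℕ → ℝ := fun n => exp 1 * Φ ^ (n - 1) * ψ ^ p * towerS D τ μ n p with hS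
  set tail := ψ ^ p * (exp 1 * V * (Φ * V) ^ N / (1 - Φ * V)) with htail
  have htail0 : 0 ≤ tail := by
    rw [htail]; exact mul_nonneg (pow_nonneg hψ _) (div_nonneg (by positivity) (sub_nonneg.2 hguard.le))
  have hS0 : ∀ n, 0 ≤ S n := fun n => by
    have := towerS_nonneg (D := D) hτ hμ n p; simp only [hS]; positivity
  -- graded orders `[2, N+K]` = `[2, N]` + the extra orders, the latter under the tail at `N`
  have hsplit : ∑ n ∈ Icc 2 (N + K + 1 - 1), S n ≤ ∑ n ∈ Icc 2 N, S n + tail := by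
    rw [show N + K + 1 - 1 = N + K by omega]
    rcases Nat.lt_or_ge (N + K) 2 with hlt | hge
    · have hK0 : Icc 2 (N + K) = ∅ := Finset.Icc_eq_empty (by omega)
      rw [hK0, sum_empty]
      exact add_nonneg (sum_nonneg fun n _ => hS0 n) htail0
    · have hIcc : Icc 2 (N + K) = Ico 2 (N + K + 1) := by ext n; simp only [mem_Icc, mem_Ico]; omega
      have hIcc' : Icc 2 N = Ico 2 (N + 1) := by ext n; simp only [mem_Icc, mem_Ico]; omega
      rw [hIcc, hIcc', ← Finset.sum_Ico_consecutive S (show 2 ≤ N + 1 by omega) (show N + 1 ≤ N + K + 1 by omega)]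
      exact add_le_add le_rfl (sum_extraOrders_le_kitTail (D := D) (p := p) (N := N) (K := K) hτ hψ hΦ hμ hguard)
  -- the door's tail at depth `N + K` pays `(ΦV)^K ≤ (1/2)^K ≤ w` on the kit tail at `N`
  have htailK : ψ ^ p * (exp 1 * V * (Φ * V) ^ (N + K + 1 - 1) / (1 - Φ * V)) ≤ w * tail := by
    rw [show N + K + 1 - 1 = N + K by omega, htail, pow_add]
    have hK' : (Φ * V) ^ K ≤ w := le_trans (pow_le_pow_left₀ hΦV0 hΦVhalf K) hK
    have h1 : 0 < 1 - Φ * V := sub_pos.2 hguard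
    calc ψ ^ p * (exp 1 * V * ((Φ * V) ^ N * (Φ * V) ^ K) / (1 - Φ * V))
        = (Φ * V) ^ K * (ψ ^ p * (exp 1 * V * (Φ * V) ^ N / (1 - Φ * V))) := by
          field_simp
      _ ≤ w * (ψ ^ p * (exp 1 * V * (Φ * V) ^ N / (1 - Φ * V))) :=
          mul_le_mul_of_nonneg_right hK' (mul_nonneg (pow_nonneg hψ _) (div_nonneg (by positivity) h1.le))
  -- `Φ ≤ 2Φ` on the kept orders, `2·tail(Φ) ≤ tail(2Φ)`
  have hsum2 : ∑ n ∈ Icc 2 N, S n ≤ ∑ n ∈ Icc 2 N, exp 1 * (2 * Φ) ^ (n - 1) * ψ ^ p * towerS D τ μ n p :=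
    sum_le_sum fun n _ => by
      simp only [hS]
      refine mul_le_mul_of_nonneg_right (mul_le_mul_of_nonneg_right (mul_le_mul_of_nonneg_left
        (pow_le_pow_left₀ hΦ (by linarith) _) (exp_pos 1).le) (pow_nonneg hψ _)) (towerS_nonneg hτ hμ n p)
  have htail2 : 2 * tail ≤ ψ ^ p * (exp 1 * V * (2 * Φ * V) ^ N / (1 - 2 * Φ * V)) := by
    rw [htail, mul_left_comm]
    exact mul_le_mul_of_nonneg_left (two_mul_kitTail_le hV0 hΦ (by rw [hVdef]; linarith [hguard2]) hN) (pow_nonneg hψ _)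
  calc w * ∑ n ∈ Icc 2 (N + K + 1 - 1), S n + ψ ^ p * (exp 1 * V * (Φ * V) ^ (N + K + 1 - 1) / (1 - Φ * V))
      ≤ w * (∑ n ∈ Icc 2 N, S n + tail) + w * tail := add_le_add (mul_le_mul_of_nonneg_left hsplit hw0) htailK
    _ = w * (∑ n ∈ Icc 2 N, S n + 2 * tail) := by ring
    _ ≤ w * (∑ n ∈ Icc 2 N, exp 1 * (2 * Φ) ^ (n - 1) * ψ ^ p * towerS D τ μ n p +
          ψ ^ p * (exp 1 * V * (2 * Φ * V) ^ N / (1 - 2 * Φ * V))) :=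
        mul_le_mul_of_nonneg_left (add_le_add hsum2 htail2) hw0

/-- **THE DEPTH ROW FOR THE FLOOR WEIGHT**: `(1/2)^{2J} ≤ ((1/2)^J)^{lumps F}` for every level `F` (`lumps F ≤ 2`) — in the tower (`θ = (1/2)^{dk−1}`) the depth
`K := 2(dk−1)` serves every output level at once. -/
theorem half_pow_two_mul_le_pow_lumps (J F : ℕ) : (1 / 2 : ℝ) ^ (2 * J) ≤ ((1 / 2 : ℝ) ^ J) ^ lumps F := by
  rw [← pow_mul, mul_comm J]
  exact pow_le_pow_of_le_one (by norm_num) (by norm_num) (Nat.mul_le_mul_right J (by unfold lumps; omega))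

/-- The same depth row stated with the tower's block data (`J = dk − 1`), for the rethread's `hK`. -/
theorem half_pow_le_towerTheta_pow_lumps (d k F : ℕ) :
    (1 / 2 : ℝ) ^ (2 * (d * k - 1)) ≤ ((1 / 2 : ℝ) ^ (d * k - 1)) ^ lumps F :=
  half_pow_two_mul_le_pow_lumps (d * k - 1) F

/-- **The floor weight is at most one**: `((1/2)^J)^{lumps F} ≤ 1`. -/
theorem towerTheta_pow_lumps_le_one (J F : ℕ) : ((1 / 2 : ℝ) ^ J) ^ lumps F ≤ 1 :=
  pow_le_one₀ (by positivity) (pow_le_one₀ (by norm_num) (by norm_num))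

end Summit.HubbardSuperconductivity.HubbardSuperconductivity.Theorems.EngineV8

end
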